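import Summits.HodgeConjecture.HodgeConjecture.Theorems.Ring2AbelianAllAndreWeilFieldIsogenyAnchors
import Summits.HodgeConjecture.HodgeConjecture.Theorems.Ring2WeilCoverageCMFieldCellsNonGalois
import HarnessLib

/-!
# Ring 2 · AbelianAll — ANDRÉ AXIS, PART S-b: ∃ ANCHOR ∀ PENCILS ON EVERY `δ`-COMPONENT OF A CM FIELD — for every CM field `E` admitting a
  nondegenerate CM type (every cyclic one; every quartic one, Galois or not), every `E`-rank `2p` and EVERY discriminant class
  `δ ∈ E⁺ˣ/N(Eˣ)`, ring2-b03's CM power member `B^p × (B^ρ)^p` — of Weil type relative to `E`, with a Rosati-compatible polarization class of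
  discriminant `δ`, satisfying the HODGE CONJECTURE — anchors EVERY compact pencil of abelian `2pe₀`-folds with a global `E`-action through an
  `E`-isogenous chart: `B⋆` of the ONE total space ⟹ the `E`-Weil classes of EVERY member are algebraic, and every member is of Weil type relative
  to `E` (fact-free; the δ-indexed CM-field form of parts Q-d / R-e; owed item (o156))

HONEST FRAMING (page 1, verbatim): **research route, not a corollary; conditional on HC_CM plus one named minimal statement.** Cell line:
research route conditional on HC_CM; not a corollary; Q11.4-sentence-2 already refuted in dim ≥ 3. Nothing in this file proves a case of the
Hodge conjecture beyond what the tree proves outright (Pohlmann: `Hdg = Div` on powers of a realisation of a nondegenerate CM type) or of `B(X)`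
for a named `X`: the pencil rows are IMPLICATIONS with displayed hypotheses. `HC_CM` (`Theses.RankFourFaces.CMAbelianHodge`), `HC_AV` and the
global nodes do NOT occur. Item `Theses.RankFourFaces.CMToAbelian` (stmt-16267) stays OPEN; N104 untouched; no node is born (0 `def`, 0 `sorry`,
no named fact). Seat `pub-hodge-ring2-ab-andre-2`, gen 49 (part S). Part R-e (gen 48) exhibited ONE hypothesis-free anchor per CM datum
`(R, e₀, k)` — Deligne's tensor point, polarized SPLIT — and recorded «NON-split `E`-components: no anchor exhibited (owed, (o156))». The supply
was in the tree: ring2-b03's census files (`Ring2WeilCoverageCMFieldCells{Inhabited, Nonvacuous, HodgeAtMember, NonGalois}`) place on EVERY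
δ-row `(E, 2p, δ)` of ANY CM field (given Deligne's presentation `(b₀, R)`) the CM power member `B^p × (B^ρ)^p` with a Weil-type `η` and a
Rosati-compatible polarization class of discriminant `δ`, and prove the Hodge conjecture AT it whenever `E` has a nondegenerate CM type
(`exists_cmMember_hodgeConjectureFor_of_exists_isNondegenerate`). This file composes that supply with part S-a's row through an `E`-isogenous chart.

## Content (theorems only; standard axioms)

* **`exists_componentAnchor_forall_weilFieldPencil`** — ∃ ANCHOR ∀ PENCILS, PER COMPONENT: `K` a CM field with `[K:ℚ] = 2e₀ > 2` admitting a
  nondegenerate CM type, Deligne's presentation (`b₀ ∈ 𝓞_K` purely imaginary separating the embeddings, `minpoly_ℤ(b₀) = R(T²)`, roots of `R` real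
  negative), `p ≥ 1`, ANY `δ ∈ E⁺ˣ/N(Eˣ)`: there is `(A₀, η₀, h₀)` — `A₀` of CM type, `IsWeilTypeCM A₀ η₀ R e₀ p`, `h₀` a polarization class,
  Rosati-compatible, `HasWeilDiscriminantCM … h₀ δ`, `HodgeConjectureFor A₀`, `W_E(A₀) ⊗ ℂ ⊆ Nᵖ(A₀)` — such that (i) on EVERY compact pencil
  `f : 𝒳 ⟶ S` of abelian `2pe₀`-folds with `B⋆(𝒳, η) ∀η`, a global endomorphism `Φ` over `S`, `Φ`-compatible charts `(A_s, e_s, φ_s)` with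
  `R(φ_s²) = 0`, a rational global `U` on `W_E(A_t) ⊗ ℂ` at `t` with `U|X_t ≠ 0`, and an `E`-isogeny pair between ONE chart `A_{s₀}` and `A₀`
  (`u ≫ v = n·𝟙`, `v ≫ φ_{s₀} = η₀ ≫ v`): `W_E(A_s, φ_s) ⊗ ℂ ⊆ Nᵖ(A_s)` for EVERY member; (ii) on every such pencil (no `B⋆` needed) with the
  reverse pair at `s₀` (`u ≫ η₀ = φ_{s₀} ≫ u`, `v ≫ u = n·𝟙_{A₀}`): EVERY member `(A_s, φ_s)` is of Weil type relative to `E`.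
* **`exists_componentAnchor_forall_weilFieldPencil_of_isCyclic`** — every CYCLIC Galois CM field of degree `> 2` (Schmidt Kap. III Satz 2.1:
  a nondegenerate type exists; e.g. `ℚ(ζ₅)`, `ℚ(ζ₇)`, `ℚ(√-(2+√2))`).
* **`exists_componentEightfoldAnchor_forall_weilFieldPencil_of_not_isGalois_four`** — every NON-GALOIS QUARTIC CM field (`D₄`, e.g.
  `ℚ(√-(3+√2))`; Schappacher's primitive type, nondegenerate by Yanai): on EVERY row `(E, 4, δ)` a CM EIGHTFOLD anchor with HC, and the rows
  (i)–(ii) for compact pencils of abelian EIGHTFOLDS with `E`-action (9-fold total space; codimension-2 `E`-Weil classes).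

## Honest status

Fact-free compositions (ring2-b03 supply + part S-a). HONEST COLUMN inherited from ring2-b03: `IsPolarizationClass` records «rational, supported
on a divisor, hard Lefschetz» and NO positivity, so EVERY `δ` is reached, including the classes of the wrong sign at the real places whose rows are
empty for genuinely polarized members; the Galois fields with only degenerate types (biquadratic `V₄`) are served by ring2-b03's INDUCED-type
members (`exists_cmMember_hodgeConjectureFor_of_quadratic_subfield`), not restated here. Existence of a compact pencil with a global `E`-action
through a given member and the anchor is NOT constructed (hypotheses, as on the whole axis; André's Lemme 6.3.3 is a named fact not used). What
is open is unchanged: `B⋆` of the one total space (equivalently, mod Verdier and the member hypothesis of part R-b §3, the `E`-Weil classes of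
every member); in print the `E`-Weil classes with `E⁺ ≠ ℚ` are open on every component ([Andre2026, §4.4.4]; [Markman2025SurveySecant] treats
`E⁺ = ℚ`). Nothing minimal claimed; N104 untouched. EDGE LABELS: all theorems K (fact-free; hypothesis-free existence of the anchors).
References: Deligne1982HodgeCycles (§4 (4.4), Prop. 4.4, Lemma 4.6, Remark 4.10, proof of Thm. 4.8; §5 (b)–(c) pp. 38–39); Pohlmann1968 (Thm. 1);
Schmidt1984CMArithmetik (Kap. II Satz 1.6, Kap. III Satz 2.1); Yanai1985 (§4); MoonenZarhin1998WeilClasses (§1); Andre1996Motifs (§6.3 Lemme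
6.3.3, Remarque 2); Abdulali1994FamiliesAV (Thm. 5.5); Andre2026 (§4.4.4); Landherr1936HermitianForms.
-/

noncomputable section

set_option linter.dupNamespace false

namespace Summit.HodgeConjecture.HodgeConjecture.Ring2.AbelianAll

open CategoryTheory AlgebraicGeometry Polynomial NumberField
open Literature.AlgebraicGeometry Literature.AlgebraicGeometry.Motives
open Literature.AlgebraicGeometry.HodgeTheory Literature.AlgebraicGeometry.Deligne1982
open Literature.AlgebraicGeometry.Milne1999 (IsOfCMType)
open Literature.AlgebraicGeometry.Pohlmann1968 (IsNondegenerate isNondegenerate_of_isPrimitive_of_prime)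
open Literature.NumberTheory.ComplexMultiplication (PrimitiveCMTypeNonGalois.exists_isPrimitive_of_not_isGalois)
open Summit.HodgeConjecture.HodgeConjecture.Ring2.Hypotheses (RosatiCompatible)
open Summit.HodgeConjecture.HodgeConjecture.Ring2.WeilCoverageCM (exists_cmMember_hodgeConjectureFor_of_exists_isNondegenerate)

variable (K : Type) [Field K] [NumberField K] [IsCMField K]

/-- **∃ ANCHOR ∀ PENCILS ON EVERY `δ`-COMPONENT** (the δ-indexed CM-field form of parts Q-d / R-e; fact-free). Let `K` be a CM field of degree
`2e₀ > 2` admitting a NONDEGENERATE CM type, with Deligne's presentation: `b₀ ∈ 𝓞_K` purely imaginary separating the complex embeddings,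
`minpoly_ℤ(b₀) = R(T²)` (`R` monic of degree `e₀`, roots real negative, `R(T²)` irreducible; `E = ℚ[T]/(R(T²)) ≅ K`). For every `p ≥ 1` and EVERY
class `δ ∈ E⁺ˣ/N(Eˣ)` there is a triple `(A₀, η₀, h₀)` — ring2-b03's CM power member `B^p × (B^ρ)^p`: `A₀` of CM type, `(A₀, η₀)` of Weil type
relative to `E` with `dim_E H¹ = 2p` (`IsWeilTypeCM A₀ η₀ R e₀ p`), `h₀` a polarization class whose Rosati involution induces complex conjugation
on `E` and whose hermitian form has discriminant `δ` (`HasWeilDiscriminantCM`), the HODGE CONJECTURE holding for `A₀` (Pohlmann, kernel) and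
`W_E(A₀) ⊗ ℂ ⊆ Nᵖ(A₀)` — such that:
(i) for EVERY compact pencil `f : 𝒳 ⟶ S` of abelian `2pe₀`-folds with `B⋆(𝒳, η)` for every `η`, a global endomorphism `Φ` over `S`, `Φ`-compatible
charts `(A_s, e_s, φ_s)` with `R(φ_s²) = 0`, a RATIONAL global `U ∈ H^{2p}(𝒳(ℂ); ℂ)` with `e_t^*(U|X_t) ∈ W_E(A_t, φ_t) ⊗ ℂ` and `U|X_t ≠ 0`, and an
`E`-isogeny pair between ONE chart `A_{s₀}` and the anchor (`u : A_{s₀} ⟶ A₀`, `v : A₀ ⟶ A_{s₀}`, `u ≫ v = n·𝟙`, `n ≥ 1`, `v ≫ φ_{s₀} = η₀ ≫ v`):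
**`W_E(A_s, φ_s) ⊗ ℂ ⊆ Nᵖ(A_s)` for EVERY member `s`**;
(ii) for every such pencil WITHOUT the `B⋆` hypothesis, with a pair `u : A_{s₀} ⟶ A₀`, `u ≫ η₀ = φ_{s₀} ≫ u`, `v : A₀ ⟶ A_{s₀}`, `v ≫ u = n·𝟙_{A₀}`:
**every member `(A_s, φ_s)` is of Weil type relative to `E`** (`IsWeilTypeCM (A s) (φ s) R e₀ p`).
No θ_N, no group law, no Verdier, no `HC_CM`, no Hodge–Weil theorem in print. [cite: Deligne1982HodgeCycles, §4 (4.4), Lemma 4.6, Remark 4.10 and §5 (c) pp. 38–39]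
[cite: Pohlmann1968, Thm. 1] [cite: Andre1996Motifs, §6.3 Lemme 6.3.3 and Remarque 2 (p. 33)] [cite: MoonenZarhin1998WeilClasses, §1 (dim_F W_F = 1; Criterion)]
[cite: Abdulali1994FamiliesAV, Theorem 5.5 (p. 1130)] [cite: Andre2026, §4.4.4] -/
theorem exists_componentAnchor_forall_weilFieldPencil (hK : 2 < Module.finrank ℚ K)
    {b₀ : 𝓞 K} (hb₀ : IsCMField.complexConj K (b₀ : K) = -(b₀ : K))
    (hsep : Function.Injective fun σ : K →+* ℂ => σ (b₀ : K))
    {R : Polynomial ℤ} {e₀ : ℕ} (he : Module.finrank ℚ K = 2 * e₀) (hRm : R.Monic) (hRdeg : R.natDegree = e₀)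
    (hR : R.comp (X ^ 2) = minpoly ℤ b₀) (hirr : Irreducible (cmPolyQ R))
    (hroots : ∀ s : ℂ, Polynomial.eval₂ (Int.castRingHom ℂ) s R = 0 → s.im = 0 ∧ s.re < 0)
    (haev : Polynomial.aeval (b₀ : K) (cmPolyQ R) = 0) (hdegQ : (cmPolyQ R).natDegree = Module.finrank ℚ K)
    [Fact (Irreducible (realPolyQ R))] (hnd : ∃ Ψ : CMType K, IsNondegenerate Ψ) {p : ℕ} (hp : 0 < p)
    (δ : cmNormResidueGroup R) :
    ∃ (A₀ : AbelianVariety ℂ) (η₀ : A₀ ⟶ A₀) (h₀ : complexBetti A₀.X 2),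
      (IsOfCMType A₀ ∧ IsWeilTypeCM A₀ η₀ R e₀ p ∧ IsPolarizationClass A₀.dim A₀.X h₀ ∧ RosatiCompatible A₀ η₀ h₀ ∧
        HasWeilDiscriminantCM A₀ η₀ R e₀ p h₀ δ ∧ HodgeConjectureFor A₀.dim A₀.X ∧
        weilClassesField A₀ η₀ (R.comp (X ^ 2)) (2 * p) ≤ algebraicClasses A₀.X p) ∧
      (∀ {𝒳 S : SchemeOver ℂ} {f : 𝒳 ⟶ S} (_hf : IsCompactAbelianPencil f (2 * p * e₀))
        (_hB : ∀ ηX : complexBetti 𝒳 2, StandardConjectureBStar (2 * p * e₀ + 1) 𝒳 ηX)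
        (Φ : 𝒳 ⟶ 𝒳) (_hΦ : Φ ≫ f = f)
        (A : ComplexPoints S → AbelianVariety ℂ) (e : ∀ s, (A s).X ≅ fiberOver f s) (φ : ∀ s, A s ⟶ A s)
        (_hK : ∀ s, ∃ Φs : fiberOver f s ⟶ fiberOver f s,
          Φs ≫ fiberι f s = fiberι f s ≫ Φ ∧ (e s).hom ≫ Φs = (φ s).hom.hom.hom ≫ (e s).hom)
        (_hP : ∀ s, Polynomial.eval₂ (Int.castRingHom (CategoryTheory.End (A s))) ((φ s : CategoryTheory.End (A s)))
          (R.comp (X ^ 2)) = 0)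
        (U : complexBetti 𝒳 (2 * p)) (_hUQ : IsRationalClass U) {t : ComplexPoints S}
        (_hUt : complexBetti.map (e t).hom (2 * p) (complexBetti.map (fiberι f t) (2 * p) U) ∈
          weilClassesField (A t) (φ t) (R.comp (X ^ 2)) (2 * p))
        (_hU0 : complexBetti.map (fiberι f t) (2 * p) U ≠ 0)
        {s₀ : ComplexPoints S} (u : A s₀ ⟶ A₀) (v : A₀ ⟶ A s₀) {n : ℕ} (_hn : 0 < n) (_huv : u ≫ v = n • 𝟙 (A s₀))
        (_hv : v ≫ φ s₀ = η₀ ≫ v) (s : ComplexPoints S),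
        weilClassesField (A s) (φ s) (R.comp (X ^ 2)) (2 * p) ≤ algebraicClasses (A s).X p) ∧
      (∀ {𝒳 S : SchemeOver ℂ} {f : 𝒳 ⟶ S} {d : ℕ} (_hf : IsCompactAbelianPencil f d)
        (Φ : 𝒳 ⟶ 𝒳) (_hΦ : Φ ≫ f = f)
        (A : ComplexPoints S → AbelianVariety ℂ) (e : ∀ s, (A s).X ≅ fiberOver f s) (φ : ∀ s, A s ⟶ A s)
        (_hK : ∀ s, ∃ Φs : fiberOver f s ⟶ fiberOver f s,
          Φs ≫ fiberι f s = fiberι f s ≫ Φ ∧ (e s).hom ≫ Φs = (φ s).hom.hom.hom ≫ (e s).hom)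
        (_hP : ∀ s, Polynomial.eval₂ (Int.castRingHom (CategoryTheory.End (A s))) ((φ s : CategoryTheory.End (A s)))
          (R.comp (X ^ 2)) = 0)
        (U : complexBetti 𝒳 (2 * p)) (_hUQ : IsRationalClass U) {t : ComplexPoints S}
        (_hUt : complexBetti.map (e t).hom (2 * p) (complexBetti.map (fiberι f t) (2 * p) U) ∈
          weilClassesField (A t) (φ t) (R.comp (X ^ 2)) (2 * p))
        (_hU0 : complexBetti.map (fiberι f t) (2 * p) U ≠ 0)
        {s₀ : ComplexPoints S} (_hdim : (A s₀).dim = A₀.dim) (u : A s₀ ⟶ A₀) (v : A₀ ⟶ A s₀) {n : ℕ} (_hn : 0 < n)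
        (_hvu : v ≫ u = n • 𝟙 A₀) (_hu : u ≫ η₀ = φ s₀ ≫ u) (s : ComplexPoints S),
        IsWeilTypeCM (A s) (φ s) R e₀ p) := by
  obtain ⟨A₀, η₀, h₀, hcm, hW, hpol, hros, hdisc, hHC, halg⟩ :=
    exists_cmMember_hodgeConjectureFor_of_exists_isNondegenerate K hK hb₀ hsep he hRm hRdeg hR hirr hroots haev hdegQ hnd hp δ
  refine ⟨A₀, η₀, h₀, ⟨hcm, hW, hpol, hros, hdisc, hHC, halg⟩, ?_, ?_⟩
  · intro 𝒳 S f hf hB Φ hΦ A e φ hK' hP U hUQ t hUt hU0 s₀ u v n hn huv hv s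
    exact weilClassesField_le_algebraicClasses_forall_of_lefschetzB_of_isogenyPair_weilTypeCM_hodge_chart hf hB Φ hΦ A e φ hK' hP U hUQ
      hUt hU0 hW hHC u v hn huv hv s
  · intro 𝒳 S f d hf Φ hΦ A e φ hK' hP U hUQ t hUt hU0 s₀ hdim u v n hn hvu hu s
    exact isWeilTypeCM_member_of_isogenyPair_weilTypeCM_chart hf Φ hΦ A e φ hK' hP U hUQ hUt hU0 hW hdim u v hn hvu hu s

/-- **Every CYCLIC Galois CM field of degree `> 2`** (Schmidt Kap. III Satz 2.1 / Kor. 3.3 in the tree: a cyclic CM field has a nondegenerate CM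
type): ∃ anchor ∀ pencils on EVERY `δ`-component, both rows of `exists_componentAnchor_forall_weilFieldPencil`. Covers `ℚ(ζ₅)`, `ℚ(ζ₇)`, `ℚ(ζ₉)`,
`ℚ(√-(2+√2))`, every `ℚ(ζ_{ℓ^a})`. [cite: Schmidt1984CMArithmetik, Kap. III Satz 2.1] [cite: Pohlmann1968, Thm. 1] [cite: Deligne1982HodgeCycles, §5 (c) pp. 38–39]
[cite: Andre1996Motifs, §6.3 Lemme 6.3.3 and Remarque 2 (p. 33)] -/
theorem exists_componentAnchor_forall_weilFieldPencil_of_isCyclic [IsGalois ℚ K] (hc : IsCyclic (K ≃ₐ[ℚ] K))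
    (hK : 2 < Module.finrank ℚ K)
    {b₀ : 𝓞 K} (hb₀ : IsCMField.complexConj K (b₀ : K) = -(b₀ : K))
    (hsep : Function.Injective fun σ : K →+* ℂ => σ (b₀ : K))
    {R : Polynomial ℤ} {e₀ : ℕ} (he : Module.finrank ℚ K = 2 * e₀) (hRm : R.Monic) (hRdeg : R.natDegree = e₀)
    (hR : R.comp (X ^ 2) = minpoly ℤ b₀) (hirr : Irreducible (cmPolyQ R))
    (hroots : ∀ s : ℂ, Polynomial.eval₂ (Int.castRingHom ℂ) s R = 0 → s.im = 0 ∧ s.re < 0)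
    (haev : Polynomial.aeval (b₀ : K) (cmPolyQ R) = 0) (hdegQ : (cmPolyQ R).natDegree = Module.finrank ℚ K)
    [Fact (Irreducible (realPolyQ R))] {p : ℕ} (hp : 0 < p) (δ : cmNormResidueGroup R) :
    ∃ (A₀ : AbelianVariety ℂ) (η₀ : A₀ ⟶ A₀) (h₀ : complexBetti A₀.X 2),
      (IsOfCMType A₀ ∧ IsWeilTypeCM A₀ η₀ R e₀ p ∧ IsPolarizationClass A₀.dim A₀.X h₀ ∧ RosatiCompatible A₀ η₀ h₀ ∧
        HasWeilDiscriminantCM A₀ η₀ R e₀ p h₀ δ ∧ HodgeConjectureFor A₀.dim A₀.X ∧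
        weilClassesField A₀ η₀ (R.comp (X ^ 2)) (2 * p) ≤ algebraicClasses A₀.X p) ∧
      (∀ {𝒳 S : SchemeOver ℂ} {f : 𝒳 ⟶ S} (_hf : IsCompactAbelianPencil f (2 * p * e₀))
        (_hB : ∀ ηX : complexBetti 𝒳 2, StandardConjectureBStar (2 * p * e₀ + 1) 𝒳 ηX)
        (Φ : 𝒳 ⟶ 𝒳) (_hΦ : Φ ≫ f = f)
        (A : ComplexPoints S → AbelianVariety ℂ) (e : ∀ s, (A s).X ≅ fiberOver f s) (φ : ∀ s, A s ⟶ A s)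
        (_hK : ∀ s, ∃ Φs : fiberOver f s ⟶ fiberOver f s,
          Φs ≫ fiberι f s = fiberι f s ≫ Φ ∧ (e s).hom ≫ Φs = (φ s).hom.hom.hom ≫ (e s).hom)
        (_hP : ∀ s, Polynomial.eval₂ (Int.castRingHom (CategoryTheory.End (A s))) ((φ s : CategoryTheory.End (A s)))
          (R.comp (X ^ 2)) = 0)
        (U : complexBetti 𝒳 (2 * p)) (_hUQ : IsRationalClass U) {t : ComplexPoints S}
        (_hUt : complexBetti.map (e t).hom (2 * p) (complexBetti.map (fiberι f t) (2 * p) U) ∈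
          weilClassesField (A t) (φ t) (R.comp (X ^ 2)) (2 * p))
        (_hU0 : complexBetti.map (fiberι f t) (2 * p) U ≠ 0)
        {s₀ : ComplexPoints S} (u : A s₀ ⟶ A₀) (v : A₀ ⟶ A s₀) {n : ℕ} (_hn : 0 < n) (_huv : u ≫ v = n • 𝟙 (A s₀))
        (_hv : v ≫ φ s₀ = η₀ ≫ v) (s : ComplexPoints S),
        weilClassesField (A s) (φ s) (R.comp (X ^ 2)) (2 * p) ≤ algebraicClasses (A s).X p) ∧
      (∀ {𝒳 S : SchemeOver ℂ} {f : 𝒳 ⟶ S} {d : ℕ} (_hf : IsCompactAbelianPencil f d)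
        (Φ : 𝒳 ⟶ 𝒳) (_hΦ : Φ ≫ f = f)
        (A : ComplexPoints S → AbelianVariety ℂ) (e : ∀ s, (A s).X ≅ fiberOver f s) (φ : ∀ s, A s ⟶ A s)
        (_hK : ∀ s, ∃ Φs : fiberOver f s ⟶ fiberOver f s,
          Φs ≫ fiberι f s = fiberι f s ≫ Φ ∧ (e s).hom ≫ Φs = (φ s).hom.hom.hom ≫ (e s).hom)
        (_hP : ∀ s, Polynomial.eval₂ (Int.castRingHom (CategoryTheory.End (A s))) ((φ s : CategoryTheory.End (A s)))
          (R.comp (X ^ 2)) = 0)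
        (U : complexBetti 𝒳 (2 * p)) (_hUQ : IsRationalClass U) {t : ComplexPoints S}
        (_hUt : complexBetti.map (e t).hom (2 * p) (complexBetti.map (fiberι f t) (2 * p) U) ∈
          weilClassesField (A t) (φ t) (R.comp (X ^ 2)) (2 * p))
        (_hU0 : complexBetti.map (fiberι f t) (2 * p) U ≠ 0)
        {s₀ : ComplexPoints S} (_hdim : (A s₀).dim = A₀.dim) (u : A s₀ ⟶ A₀) (v : A₀ ⟶ A s₀) {n : ℕ} (_hn : 0 < n)
        (_hvu : v ≫ u = n • 𝟙 A₀) (_hu : u ≫ η₀ = φ s₀ ≫ u) (s : ComplexPoints S),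
        IsWeilTypeCM (A s) (φ s) R e₀ p) :=
  exists_componentAnchor_forall_weilFieldPencil K hK hb₀ hsep he hRm hRdeg hR hirr hroots haev hdegQ
    (Literature.AlgebraicGeometry.Pohlmann1968.AbelianCMFieldExistence.exists_isNondegenerate_of_isCyclic hc) hp δ

/-- **Every NON-GALOIS QUARTIC CM field** (the census's `D₄` field `ℚ(√-(3+√2))`; Schappacher: a primitive CM type exists; Yanai: primitive of
prime half-degree ⟹ nondegenerate): on EVERY row `(E, 4, δ)` a CM EIGHTFOLD anchor `(A₀, η₀, h₀)` — `dim A₀ = 8`, Weil type `(R, 2, 2)`,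
Rosati-compatible polarization class of discriminant `δ`, the Hodge conjecture for `A₀` (kernel) and `W_E(A₀) ⊗ ℂ ⊂ H⁴` algebraic — anchoring
EVERY compact pencil of abelian EIGHTFOLDS with a global `E`-action through an `E`-isogenous chart: `B⋆` of the ONE 9-fold total space ⟹ the
CODIMENSION-2 `E`-Weil classes of EVERY member are algebraic; and every member is of Weil type relative to `E`. With the cyclic row and ring2-b03's
biquadratic members: every quartic CM field. [cite: Schmidt1984CMArithmetik, Kap. II Satz 1.6] [cite: Yanai1985, §4 Theorem] [cite: Pohlmann1968, Thm. 1]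
[cite: Deligne1982HodgeCycles, §4 (4.4), Lemma 4.6 and §5 (c) pp. 38–39] [cite: Andre1996Motifs, §6.3 Lemme 6.3.3 and Remarque 2 (p. 33)] [cite: Andre2026, §4.4.4] -/
theorem exists_componentEightfoldAnchor_forall_weilFieldPencil_of_not_isGalois_four (hG : ¬ IsGalois ℚ K)
    (h4 : Module.finrank ℚ K = 4)
    {b₀ : 𝓞 K} (hb₀ : IsCMField.complexConj K (b₀ : K) = -(b₀ : K))
    (hsep : Function.Injective fun σ : K →+* ℂ => σ (b₀ : K))
    {R : Polynomial ℤ} {e₀ : ℕ} (he : Module.finrank ℚ K = 2 * e₀) (hRm : R.Monic) (hRdeg : R.natDegree = e₀)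
    (hR : R.comp (X ^ 2) = minpoly ℤ b₀) (hirr : Irreducible (cmPolyQ R))
    (hroots : ∀ s : ℂ, Polynomial.eval₂ (Int.castRingHom ℂ) s R = 0 → s.im = 0 ∧ s.re < 0)
    (haev : Polynomial.aeval (b₀ : K) (cmPolyQ R) = 0) (hdegQ : (cmPolyQ R).natDegree = Module.finrank ℚ K)
    [Fact (Irreducible (realPolyQ R))] (δ : cmNormResidueGroup R) :
    ∃ (A₀ : AbelianVariety ℂ) (η₀ : A₀ ⟶ A₀) (h₀ : complexBetti A₀.X 2),
      (A₀.dim = 8 ∧ IsOfCMType A₀ ∧ IsWeilTypeCM A₀ η₀ R 2 2 ∧ IsPolarizationClass A₀.dim A₀.X h₀ ∧ RosatiCompatible A₀ η₀ h₀ ∧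
        HasWeilDiscriminantCM A₀ η₀ R 2 2 h₀ δ ∧ HodgeConjectureFor A₀.dim A₀.X ∧
        weilClassesField A₀ η₀ (R.comp (X ^ 2)) (2 * 2) ≤ algebraicClasses A₀.X 2) ∧
      (∀ {𝒳 S : SchemeOver ℂ} {f : 𝒳 ⟶ S} (_hf : IsCompactAbelianPencil f 8)
        (_hB : ∀ ηX : complexBetti 𝒳 2, StandardConjectureBStar (8 + 1) 𝒳 ηX)
        (Φ : 𝒳 ⟶ 𝒳) (_hΦ : Φ ≫ f = f)
        (A : ComplexPoints S → AbelianVariety ℂ) (e : ∀ s, (A s).X ≅ fiberOver f s) (φ : ∀ s, A s ⟶ A s)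
        (_hK : ∀ s, ∃ Φs : fiberOver f s ⟶ fiberOver f s,
          Φs ≫ fiberι f s = fiberι f s ≫ Φ ∧ (e s).hom ≫ Φs = (φ s).hom.hom.hom ≫ (e s).hom)
        (_hP : ∀ s, Polynomial.eval₂ (Int.castRingHom (CategoryTheory.End (A s))) ((φ s : CategoryTheory.End (A s)))
          (R.comp (X ^ 2)) = 0)
        (U : complexBetti 𝒳 (2 * 2)) (_hUQ : IsRationalClass U) {t : ComplexPoints S}
        (_hUt : complexBetti.map (e t).hom (2 * 2) (complexBetti.map (fiberι f t) (2 * 2) U) ∈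
          weilClassesField (A t) (φ t) (R.comp (X ^ 2)) (2 * 2))
        (_hU0 : complexBetti.map (fiberι f t) (2 * 2) U ≠ 0)
        {s₀ : ComplexPoints S} (u : A s₀ ⟶ A₀) (v : A₀ ⟶ A s₀) {n : ℕ} (_hn : 0 < n) (_huv : u ≫ v = n • 𝟙 (A s₀))
        (_hv : v ≫ φ s₀ = η₀ ≫ v) (s : ComplexPoints S),
        weilClassesField (A s) (φ s) (R.comp (X ^ 2)) (2 * 2) ≤ algebraicClasses (A s).X 2) ∧
      (∀ {𝒳 S : SchemeOver ℂ} {f : 𝒳 ⟶ S} {d : ℕ} (_hf : IsCompactAbelianPencil f d)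
        (Φ : 𝒳 ⟶ 𝒳) (_hΦ : Φ ≫ f = f)
        (A : ComplexPoints S → AbelianVariety ℂ) (e : ∀ s, (A s).X ≅ fiberOver f s) (φ : ∀ s, A s ⟶ A s)
        (_hK : ∀ s, ∃ Φs : fiberOver f s ⟶ fiberOver f s,
          Φs ≫ fiberι f s = fiberι f s ≫ Φ ∧ (e s).hom ≫ Φs = (φ s).hom.hom.hom ≫ (e s).hom)
        (_hP : ∀ s, Polynomial.eval₂ (Int.castRingHom (CategoryTheory.End (A s))) ((φ s : CategoryTheory.End (A s)))
          (R.comp (X ^ 2)) = 0)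
        (U : complexBetti 𝒳 (2 * 2)) (_hUQ : IsRationalClass U) {t : ComplexPoints S}
        (_hUt : complexBetti.map (e t).hom (2 * 2) (complexBetti.map (fiberι f t) (2 * 2) U) ∈
          weilClassesField (A t) (φ t) (R.comp (X ^ 2)) (2 * 2))
        (_hU0 : complexBetti.map (fiberι f t) (2 * 2) U ≠ 0)
        {s₀ : ComplexPoints S} (_hdim : (A s₀).dim = A₀.dim) (u : A s₀ ⟶ A₀) (v : A₀ ⟶ A s₀) {n : ℕ} (_hn : 0 < n)
        (_hvu : v ≫ u = n • 𝟙 A₀) (_hu : u ≫ η₀ = φ s₀ ≫ u) (s : ComplexPoints S),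
        IsWeilTypeCM (A s) (φ s) R 2 2) := by
  have he₀ : e₀ = 2 := by omega
  subst he₀
  obtain ⟨Θ, hΘ⟩ := PrimitiveCMTypeNonGalois.exists_isPrimitive_of_not_isGalois (K := K) hG
  obtain ⟨φ₀⟩ : Nonempty (K →+* ℂ) := inferInstance
  have hnd : IsNondegenerate Θ := isNondegenerate_of_isPrimitive_of_prime Nat.prime_two h4 φ₀ (hΘ φ₀)
  obtain ⟨A₀, η₀, h₀, ⟨hcm, hW, hpol, hros, hdisc, hHC, halg⟩, hrow, htype⟩ :=
    exists_componentAnchor_forall_weilFieldPencil K (by omega) hb₀ hsep he hRm hRdeg hR hirr hroots haev hdegQ ⟨Θ, hnd⟩ two_pos δ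
  refine ⟨A₀, η₀, h₀, ⟨by rw [hW.dim_eq]; rfl, hcm, hW, hpol, hros, hdisc, hHC, halg⟩, ?_, htype⟩
  intro 𝒳 S f hf hB Φ hΦ A e φ hK' hP U hUQ t hUt hU0 s₀ u v n hn huv hv s
  exact hrow hf hB Φ hΦ A e φ hK' hP U hUQ hUt hU0 u v hn huv hv s

end Summit.HodgeConjecture.HodgeConjecture.Ring2.AbelianAll

end
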